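import Mathlib

/-!
# The singlet-pair ceiling: an abstract CAR identity

HONEST FRAMING: first certified bounds; not a superconductivity verdict; every number certified or
labelled float.  This file contains objects and exact identities only (speedrun `mbsolver`, seat
sr-mbsolver-m3-2, gen 11); it is consumed by `LocalPairCeiling`.

For four fermion modes `x₀, x₁, x₂, x₃` (annihilators; `star xᵢ` the creators) satisfying the CAR,
the singlet pair `B = x₀ x₃ - x₁ x₂` obeys the sum-of-squares identity

`2 - B⋆ B = T⋆ T + 2 R⋆ R`, `T = x₀ x₃ (1 - n₁ n₂) + x₁ x₂ (1 - n₀ n₃)`, `R = (1 - n₀ n₃)(1 - n₁ n₂)`,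

`nᵢ = xᵢ⋆ xᵢ`; hence `B⋆ B ≤ 2` in every `*`-representation.  With `x₀, x₁ = c_{x↑}, c_{x↓}` and
`x₂, x₃` the normalised bond modes `b_↑, b_↓` of a local `d`-wave pair `P_x = √2 · B`, this is the
sharp kinematic ceiling `P_x⋆ P_x ≤ 4`.

References: folklore (CAR normal ordering); D. J. Scalapino, Phys. Rep. 250 (1995) 329, §2 (the pair
operators).
-/

namespace Summit.Ventures.CertifiedManyBodySolver.Observables

namespace SingletPair

/-- **Singlet-pair sum of squares.**  In any `*`-ring, four CAR modes `x₀ … x₃` satisfy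
`2 - B⋆B = T⋆T + 2·R⋆R` for the singlet pair `B = x₀x₃ - x₁x₂`,
`T = x₀x₃(1 - n₁n₂) + x₁x₂(1 - n₀n₃)`, `R = (1 - n₀n₃)(1 - n₁n₂)`, `nᵢ = xᵢ⋆xᵢ`. [folklore] -/
theorem two_sub_star_pair_mul_pair_eq {A : Type*} [Ring A] [StarRing A] (x : Fin 4 → A)
    (hx0 : ∀ i, x i * x i = 0)
    (hxx : ∀ i j, x i * x j + x j * x i = 0)
    (hxs : ∀ i j, i ≠ j → x i * star (x j) + star (x j) * x i = 0)
    (hcar : ∀ i, x i * star (x i) + star (x i) * x i = 1) :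
    2 - star (x 0 * x 3 - x 1 * x 2) * (x 0 * x 3 - x 1 * x 2) =
      star (x 0 * x 3 * (1 - star (x 1) * x 1 * (star (x 2) * x 2)) +
            x 1 * x 2 * (1 - star (x 0) * x 0 * (star (x 3) * x 3))) *
          (x 0 * x 3 * (1 - star (x 1) * x 1 * (star (x 2) * x 2)) +
            x 1 * x 2 * (1 - star (x 0) * x 0 * (star (x 3) * x 3))) +
        2 * (star ((1 - star (x 0) * x 0 * (star (x 3) * x 3)) *
                (1 - star (x 1) * x 1 * (star (x 2) * x 2))) *
          ((1 - star (x 0) * x 0 * (star (x 3) * x 3)) *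
            (1 - star (x 1) * x 1 * (star (x 2) * x 2)))) := by
  -- oriented normal-ordering rules (creators `star (x i)` to the left, indices sorted)
  have sx0 : ∀ i, star (x i) * star (x i) = 0 := fun i => by rw [← star_mul, hx0, star_zero]
  have rxx : ∀ i j, i < j → x j * x i = -(x i * x j) := fun i j _ =>
    eq_neg_of_add_eq_zero_right (hxx i j)
  have ryy : ∀ i j, i < j → star (x j) * star (x i) = -(star (x i) * star (x j)) := by
    intro i j _
    have h := congrArg star (hxx j i)
    rw [star_add, star_mul, star_mul, star_zero] at h
    exact eq_neg_of_add_eq_zero_right h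
  have rxy : ∀ i j, i ≠ j → x i * star (x j) = -(star (x j) * x i) := fun i j h =>
    eq_neg_of_add_eq_zero_left (hxs i j h)
  have rcar : ∀ i, x i * star (x i) = 1 - star (x i) * x i := fun i => eq_sub_of_add_eq (hcar i)
  have hx0' : ∀ i (w : A), x i * (x i * w) = 0 := fun i w => by rw [← mul_assoc, hx0, zero_mul]
  have sx0' : ∀ i (w : A), star (x i) * (star (x i) * w) = 0 := fun i w => by
    rw [← mul_assoc, sx0, zero_mul]
  have rxx' : ∀ i j (w : A), i < j → x j * (x i * w) = -(x i * (x j * w)) := fun i j w h => by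
    rw [← mul_assoc, rxx i j h, neg_mul, mul_assoc]
  have ryy' : ∀ i j (w : A), i < j → star (x j) * (star (x i) * w) = -(star (x i) * (star (x j) * w)) :=
    fun i j w h => by rw [← mul_assoc, ryy i j h, neg_mul, mul_assoc]
  have rxy' : ∀ i j (w : A), i ≠ j → x i * (star (x j) * w) = -(star (x j) * (x i * w)) :=
    fun i j w h => by rw [← mul_assoc, rxy i j h, neg_mul, mul_assoc]
  have rcar' : ∀ i (w : A), x i * (star (x i) * w) = w - star (x i) * (x i * w) := fun i w => by
    rw [← mul_assoc, rcar, sub_mul, one_mul, mul_assoc]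
  -- `rxy`, `rcar`, `sx0` enter only through their right-associated forms
  simp (disch := decide) only [star_mul, star_sub, star_add, star_neg, star_one, star_star, mul_add,
    add_mul, mul_sub, sub_mul, mul_one, one_mul, mul_zero, mul_assoc, neg_mul, mul_neg, neg_neg,
    neg_zero, sub_zero, add_zero, zero_add, two_mul, hx0, hx0', sx0', rxx, rxx', ryy, ryy', rxy',
    rcar']
  noncomm_ring

/-- The same identity for four named modes, with the CAR supplied pairwise (`xᵢ² = 0`, the six pure and
six mixed off-diagonal anticommutators, the four diagonal ones). [folklore] -/
theorem two_sub_star_pair_mul_pair_eq_of {A : Type*} [Ring A] [StarRing A] (x0 x1 x2 x3 : A)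
    (z0 : x0 * x0 = 0) (z1 : x1 * x1 = 0) (z2 : x2 * x2 = 0) (z3 : x3 * x3 = 0)
    (p01 : x0 * x1 + x1 * x0 = 0) (p02 : x0 * x2 + x2 * x0 = 0) (p03 : x0 * x3 + x3 * x0 = 0)
    (p12 : x1 * x2 + x2 * x1 = 0) (p13 : x1 * x3 + x3 * x1 = 0) (p23 : x2 * x3 + x3 * x2 = 0)
    (d0 : x0 * star x0 + star x0 * x0 = 1) (d1 : x1 * star x1 + star x1 * x1 = 1)
    (d2 : x2 * star x2 + star x2 * x2 = 1) (d3 : x3 * star x3 + star x3 * x3 = 1)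
    (m01 : x0 * star x1 + star x1 * x0 = 0) (m02 : x0 * star x2 + star x2 * x0 = 0)
    (m03 : x0 * star x3 + star x3 * x0 = 0) (m12 : x1 * star x2 + star x2 * x1 = 0)
    (m13 : x1 * star x3 + star x3 * x1 = 0) (m23 : x2 * star x3 + star x3 * x2 = 0) :
    2 - star (x0 * x3 - x1 * x2) * (x0 * x3 - x1 * x2) =
      star (x0 * x3 * (1 - star x1 * x1 * (star x2 * x2)) +
            x1 * x2 * (1 - star x0 * x0 * (star x3 * x3))) *
          (x0 * x3 * (1 - star x1 * x1 * (star x2 * x2)) +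
            x1 * x2 * (1 - star x0 * x0 * (star x3 * x3))) +
        2 * (star ((1 - star x0 * x0 * (star x3 * x3)) * (1 - star x1 * x1 * (star x2 * x2))) *
          ((1 - star x0 * x0 * (star x3 * x3)) * (1 - star x1 * x1 * (star x2 * x2)))) := by
  -- reversed mixed relations (apply `star`) and swapped pure ones
  have rev : ∀ {a b : A}, a * star b + star b * a = 0 → b * star a + star a * b = 0 := by
    intro a b h
    have h' := congrArg star h
    rw [star_add, star_mul, star_mul, star_star, star_zero] at h'
    exact h'
  have sw : ∀ {a b : A}, a * b + b * a = 0 → b * a + a * b = 0 := fun h => (add_comm _ _).trans h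
  have self2 : ∀ {a : A}, a * a = 0 → a * a + a * a = 0 := fun h => by rw [h, add_zero]
  exact two_sub_star_pair_mul_pair_eq ![x0, x1, x2, x3]
    (by intro i; fin_cases i <;> first | exact z0 | exact z1 | exact z2 | exact z3)
    (by
      intro i j
      fin_cases i <;> fin_cases j <;>
        first
        | exact self2 z0 | exact self2 z1 | exact self2 z2 | exact self2 z3
        | exact p01 | exact p02 | exact p03 | exact p12 | exact p13 | exact p23
        | exact sw p01 | exact sw p02 | exact sw p03 | exact sw p12 | exact sw p13 | exact sw p23)
    (by
      intro i j hij
      fin_cases i <;> fin_cases j <;>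
        first
        | exact absurd rfl hij
        | exact m01 | exact m02 | exact m03 | exact m12 | exact m13 | exact m23
        | exact rev m01 | exact rev m02 | exact rev m03 | exact rev m12 | exact rev m13
        | exact rev m23)
    (by intro i; fin_cases i <;> first | exact d0 | exact d1 | exact d2 | exact d3)

end SingletPair

end Summit.Ventures.CertifiedManyBodySolver.Observables
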